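import Summits.Parity.BatemanHorn.Theorems.AlmostPrimeZerosSystemZeroRepulsionApTwistedEulerData
import Summits.Parity.BatemanHorn.Theorems.AlmostPrimeZerosDiscMajorantLogCappedEulerDataSharp
import HarnessLib

/-!
# The twisted capped Euler product as SHARP engine data (stub `stub_apTwistedEulerDataSharp`)

Crux stmt-Parity-17114 (`Summit.Parity.BatemanHorn.Theses.AlmostPrimeZeros.DiscMajorantLog`), line
`Sketch`, stub `stub_apTwistedEulerDataSharp`: the Dirichlet-character twin of E1
(`AlmostPrimeZerosDiscMajorantLogCappedEulerDataSharp.lean`, `stub_cappedEulerDataSharp`) at the crux's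
sharp parameters, i.e. the merge of two landed files:

* `AlmostPrimeZerosSystemZeroRepulsionApTwistedEulerCore/Data.lean` (crux stmt-Parity-11291): for a
  Dirichlet character `χ mod q`, `a(n) = χ(n) z^{s(n)}` (`s(n) = Σ_{p^v ∥ n} min(v,2)`), `w_p = χ(p) p^{-s}`
  and Selberg's factors `E(w, z) = (1 + z w + z² w²/(1 − w))·exp(z Log(1 − w))`, the product
  `G(s) = ∏_p E(w_p, z)` is holomorphic on `σ > 1/2` (`ApTwistedEuler.differentiableOn_tprod_factor`),
  `Σ a(n) n^{-s} = exp(z Σ_p −Log(1 − w_p)) G(s)` on `σ > 1` (`ApTwistedEuler.LSeries_eq`), and for the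
  principal character `Σ_p −Log(1 − χ₀(p) p^{-s}) = log ζ(s) + Σ_{p ∣ q} Log(1 − p^{-s})`
  (`ApTwistedEuler.tsum_neg_log_one_sub_twist_one`, correction bounded by `norm_corr_le`);
* E1: the two norm bounds on the THIN half-plane `σ > σ₁ = 1 − 1/(4(R+1))` with budget
  `exp(b (1+R) log(R+2))` (`CappedEulerSharp.norm_capFactor_le_crude/quad`, `tsum_norm_term_le_sharp`).

Here:

* `norm_tprod_twist_le_sharp` — `‖G(s)‖ ≤ exp(99 (1+R) log(R+2))` for `σ > σ₁`, `‖z‖ ≤ R`: E1's proof of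
  `norm_tprod_factor_le_sharp` verbatim with `w_p` in place of `p^{-s}` (every estimate there only uses
  `‖p^{-s}‖ ≤ p^{δ−1}`, `δ = 1/(4(R+1))`, and `‖p^{-s}‖ ≤ 3/4`, which `‖w_p‖ ≤ p^{-σ}` also satisfies):
  an integer `8R < N ≤ 8(R+1)`, primes `p ≤ N` crude, primes `p > N` quadratic;
* `tsum_norm_term_twist_le_sharp` — `Σ ‖a(n)‖ n^{-σ} ≤ Σ |z|^{s(n)} n^{-σ} ≤ e^{100(1+R)log(R+2)} (σ−1)^{-R}`
  (`1 < σ ≤ 2`, termwise comparison `ApTwistedEuler.norm_term_twist_le` with E1);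
* **`stub_apTwistedEulerDataSharp`** with the one constant `b = 100 + 3 ω(q)` (the principal correction
  costs `e^{2 ω(q) ‖z‖} ≤ e^{3 ω(q) (1+R) log(R+2)}` as `log 2 > 2/3`; `σ₁ ≥ 3/4 > 1/2`).

Theorem-only file (no definitions).  References: H. L. Montgomery, R. C. Vaughan, *Multiplicative Number
Theory I*, CUP 2007, §7.4 (Theorem 7.18), §11.3; G. Tenenbaum, *Introduction to analytic and
probabilistic number theory*, 3rd ed., II.5 §5.1.
-/

noncomputable section

open Complex LSeries Filter Topology Finset
open Literature.NumberTheory.LFunctions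
open Summit.Parity.BatemanHorn.Cruxes.LinearCappedRepulsion.JensenStieltjesMajorant
open Summit.Parity.BatemanHorn.Cruxes.SystemZeroRepulsion.NearFar

namespace Summit.Parity.BatemanHorn.Cruxes.DiscMajorantLog.Sketch

namespace ApTwistedEulerSharp

variable {q : ℕ} (χ : DirichletCharacter ℂ q)

/-- **The explicit bound for the twisted `G` on the thin half-plane**: for `R ≥ 0`,
`σ > 1 − 1/(4(R+1))` and `‖z‖ ≤ R`, `‖∏_p E(w_p, z)‖ ≤ exp(99 (1 + R) log(R + 2))`, `w_p = χ(p) p^{-s}`.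
With `δ = 1/(4(R+1))`, an integer `8R < N ≤ 8(R+1)` (`N^δ ≤ 2`) and `‖w_p‖ ≤ p^{δ−1}`: the primes
`p ≤ N` have `‖w_p‖ ≤ 2/p`, `‖E‖ ≤ exp(3 log(R+2) + 5R/p)`, in total
`≤ exp(24(R+1)log(R+2) + 5R(1 + log N))`; the primes `p > N` have `R‖w_p‖ ≤ 2R/N ≤ 1/4`,
`‖E‖ ≤ exp(20(R+R²) p^{2δ−2})`, and `Σ_{p>N} p^{2δ−2} ≤ 8/N`, in total `≤ exp(20(1+R))`. -/
theorem norm_tprod_twist_le_sharp {s z : ℂ} {R : ℝ} (hR : 0 ≤ R)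
    (hs : 1 - 1 / (4 * (R + 1)) < s.re) (hz : ‖z‖ ≤ R) :
    ‖∏' p : Nat.Primes, (1 + z * (χ p * (p : ℂ) ^ (-s)) +
        z ^ 2 * (χ p * (p : ℂ) ^ (-s)) ^ 2 / (1 - χ p * (p : ℂ) ^ (-s))) *
          exp (z * log (1 - χ p * (p : ℂ) ^ (-s)))‖ ≤
      Real.exp (99 * (1 + R) * Real.log (R + 2)) := by
  set E : Nat.Primes → ℂ := fun p ↦ (1 + z * (χ p * (p : ℂ) ^ (-s)) +
    z ^ 2 * (χ p * (p : ℂ) ^ (-s)) ^ 2 / (1 - χ p * (p : ℂ) ^ (-s))) *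
      exp (z * log (1 - χ p * (p : ℂ) ^ (-s)))
  -- the parameters `δ` and `N`
  set δ : ℝ := 1 / (4 * (R + 1))
  have hδ0 : 0 < δ := by positivity
  have hδ1 : δ ≤ 1 / 4 := one_div_le_one_div_of_le (by norm_num) (by linarith)
  obtain ⟨N, hN8, hNR, hN88⟩ : ∃ N : ℕ, (N : ℝ) ≤ 8 * (R + 1) ∧ 8 * R < N ∧ 8 ≤ N :=
    ⟨8 * (⌊R⌋₊ + 1), by push_cast; linarith [Nat.floor_le hR],
      by push_cast; linarith [Nat.lt_floor_add_one R], by omega⟩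
  have hN1 : 1 ≤ N := by omega
  have hN8' : (8 : ℝ) ≤ N := by exact_mod_cast hN88
  have hN0 : (0 : ℝ) < N := by linarith
  obtain ⟨hlogN, hNδ⟩ := CappedEulerSharp.log_le_and_rpow_le_two hR hN0 hN8
  have hlog0 : 0 ≤ Real.log (R + 2) := Real.log_nonneg (by linarith)
  have hL2 : Real.log 2 ≤ Real.log (R + 2) := Real.log_le_log two_pos (by linarith)
  have hl2 := Real.log_two_gt_d9
  -- `‖w_p‖ ≤ p^{δ-1}` and `‖w_p‖ ≤ 3/4`
  have ht : ∀ p : Nat.Primes, ‖χ p * (p : ℂ) ^ (-s)‖ ≤ ((p : ℕ) : ℝ) ^ (δ - 1) := fun p ↦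
    (ApTwistedEuler.norm_twist_le χ p s).trans
      (Real.rpow_le_rpow_of_exponent_le (by exact_mod_cast p.prop.one_lt.le) (by linarith))
  have ht' : ∀ p : Nat.Primes, ‖χ p * (p : ℂ) ^ (-s)‖ ≤ 3 / 4 := fun p ↦
    ApTwistedEuler.norm_twist_le_three_div_four χ p (by linarith)
  -- small primes
  have hsmall : ∀ p : Nat.Primes, (p : ℕ) ≤ N →
      ‖E p‖ ≤ Real.exp (3 * Real.log (R + 2) + 5 * R * ((p : ℕ) : ℝ)⁻¹) := by
    intro p hp
    have hp0 : (0 : ℝ) < (p : ℕ) := by exact_mod_cast p.prop.pos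
    have h2 : ‖χ p * (p : ℂ) ^ (-s)‖ ≤ 2 * ((p : ℕ) : ℝ)⁻¹ := by
      calc ‖χ p * (p : ℂ) ^ (-s)‖ ≤ ((p : ℕ) : ℝ) ^ (δ - 1) := ht p
        _ = ((p : ℕ) : ℝ) ^ δ * ((p : ℕ) : ℝ)⁻¹ := by
            rw [sub_eq_add_neg, Real.rpow_add hp0, Real.rpow_neg_one]
        _ ≤ (N : ℝ) ^ δ * ((p : ℕ) : ℝ)⁻¹ := by gcongr
        _ ≤ 2 * ((p : ℕ) : ℝ)⁻¹ := by gcongr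
    refine (CappedEulerSharp.norm_capFactor_le_crude (ht' p) hz).trans (Real.exp_le_exp.2 ?_)
    nlinarith [mul_le_mul_of_nonneg_left h2 hR]
  -- large primes
  have hlarge : ∀ p : Nat.Primes, ¬(p : ℕ) ≤ N →
      ‖E p‖ ≤ Real.exp (20 * (R + R ^ 2) * ((p : ℕ) : ℝ) ^ (-(2 - 2 * δ))) := by
    intro p hp
    have hNp : (N : ℝ) ≤ (p : ℕ) := by exact_mod_cast (not_le.1 hp).le
    have hp0 : (0 : ℝ) < (p : ℕ) := by linarith
    have hRt : R * ‖χ p * (p : ℂ) ^ (-s)‖ ≤ 1 / 4 := by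
      have h1 : ‖χ p * (p : ℂ) ^ (-s)‖ ≤ 2 * (N : ℝ)⁻¹ := by
        calc ‖χ p * (p : ℂ) ^ (-s)‖ ≤ ((p : ℕ) : ℝ) ^ (δ - 1) := ht p
          _ ≤ (N : ℝ) ^ (δ - 1) := Real.rpow_le_rpow_of_nonpos hN0 hNp (by linarith)
          _ = (N : ℝ) ^ δ * (N : ℝ)⁻¹ := by
              rw [sub_eq_add_neg, Real.rpow_add hN0, Real.rpow_neg_one]
          _ ≤ 2 * (N : ℝ)⁻¹ := by gcongr
      calc R * ‖χ p * (p : ℂ) ^ (-s)‖ ≤ R * (2 * (N : ℝ)⁻¹) := mul_le_mul_of_nonneg_left h1 hR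
        _ = 2 * R / N := by ring
        _ ≤ 1 / 4 := by rw [div_le_iff₀ hN0]; linarith
    refine (CappedEulerSharp.norm_capFactor_le_quad (ht' p) hz hRt).trans (Real.exp_le_exp.2 ?_)
    refine mul_le_mul_of_nonneg_left ?_ (by positivity)
    calc ‖χ p * (p : ℂ) ^ (-s)‖ ^ 2 ≤ (((p : ℕ) : ℝ) ^ (δ - 1)) ^ 2 :=
          pow_le_pow_left₀ (norm_nonneg _) (ht p) 2
      _ = ((p : ℕ) : ℝ) ^ (-(2 - 2 * δ)) := by
          rw [← Real.rpow_natCast, ← Real.rpow_mul hp0.le]; congr 1; push_cast; ring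
  -- the bound for every finite product, split at `N`
  obtain ⟨σ₀, h1, h2⟩ := exists_between (by linarith : 1 / 2 < s.re)
  refine hasProd_le_of_prod_le
    ((ApTwistedEuler.hasProdLocallyUniformlyOn_factor χ z h1).hasProd h2).norm fun T ↦ ?_
  have hA : ∏ p ∈ T.filter (fun p : Nat.Primes ↦ (p : ℕ) ≤ N), ‖E p‖ ≤
      Real.exp (24 * (R + 1) * Real.log (R + 2) + 5 * R * (1 + Real.log N)) := by
    have hf0 : ∀ n : ℕ, 0 ≤ 3 * Real.log (R + 2) + 5 * R * (n : ℝ)⁻¹ := fun n ↦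
      add_nonneg (mul_nonneg (by norm_num) hlog0)
        (mul_nonneg (mul_nonneg (by norm_num) hR) (inv_nonneg.2 (Nat.cast_nonneg n)))
    calc ∏ p ∈ T.filter (fun p : Nat.Primes ↦ (p : ℕ) ≤ N), ‖E p‖
        ≤ ∏ p ∈ T.filter (fun p : Nat.Primes ↦ (p : ℕ) ≤ N),
            Real.exp (3 * Real.log (R + 2) + 5 * R * ((p : ℕ) : ℝ)⁻¹) :=
          Finset.prod_le_prod (fun p _ ↦ norm_nonneg _) fun p hp ↦
            hsmall p (Finset.mem_filter.1 hp).2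
      _ = Real.exp (∑ p ∈ T.filter (fun p : Nat.Primes ↦ (p : ℕ) ≤ N),
            (3 * Real.log (R + 2) + 5 * R * ((p : ℕ) : ℝ)⁻¹)) := by rw [Real.exp_sum]
      _ ≤ Real.exp (∑ n ∈ Finset.Icc 1 N, (3 * Real.log (R + 2) + 5 * R * (n : ℝ)⁻¹)) :=
          Real.exp_le_exp.2 (CappedEulerSharp.sum_filter_le_sum T _ (Finset.Icc 1 N)
            (fun p _ hp ↦ Finset.mem_Icc.2 ⟨p.prop.one_lt.le, hp⟩)
            (f := fun n : ℕ ↦ 3 * Real.log (R + 2) + 5 * R * (n : ℝ)⁻¹) hf0)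
      _ ≤ Real.exp (24 * (R + 1) * Real.log (R + 2) + 5 * R * (1 + Real.log N)) := by
          rw [Real.exp_le_exp, Finset.sum_add_distrib, Finset.sum_const, Nat.card_Icc,
            add_tsub_cancel_right, nsmul_eq_mul, ← Finset.mul_sum]
          -- the harmonic sum `Σ_{n ≤ N} 1/n ≤ 1 + log N`
          have hH := harmonic_le_one_add_log N
          rw [harmonic_eq_sum_Icc] at hH
          push_cast at hH
          nlinarith [mul_le_mul_of_nonneg_right hN8 hlog0, mul_le_mul_of_nonneg_left hH hR]
  have hB : ∏ p ∈ T.filter (fun p : Nat.Primes ↦ ¬(p : ℕ) ≤ N), ‖E p‖ ≤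
      Real.exp (20 * (1 + R)) := by
    calc ∏ p ∈ T.filter (fun p : Nat.Primes ↦ ¬(p : ℕ) ≤ N), ‖E p‖
        ≤ ∏ p ∈ T.filter (fun p : Nat.Primes ↦ ¬(p : ℕ) ≤ N),
            Real.exp (20 * (R + R ^ 2) * ((p : ℕ) : ℝ) ^ (-(2 - 2 * δ))) :=
          Finset.prod_le_prod (fun p _ ↦ norm_nonneg _) fun p hp ↦
            hlarge p (Finset.mem_filter.1 hp).2
      _ = Real.exp (20 * (R + R ^ 2) * ∑ p ∈ T.filter (fun p : Nat.Primes ↦ ¬(p : ℕ) ≤ N),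
            ((p : ℕ) : ℝ) ^ (-(2 - 2 * δ))) := by rw [Finset.mul_sum, Real.exp_sum]
      _ ≤ Real.exp (20 * (1 + R)) := by
          rw [Real.exp_le_exp]
          have htail := (CappedEulerSharp.sum_filter_le_sum T _ (Finset.Ioc N (T.sup fun p ↦ (p : ℕ)))
            (fun p hp hpN ↦ Finset.mem_Ioc.2
              ⟨not_le.1 hpN, Finset.le_sup (f := fun p : Nat.Primes ↦ (p : ℕ)) hp⟩)
            (f := fun n : ℕ ↦ (n : ℝ) ^ (-(2 - 2 * δ))) fun n ↦ Real.rpow_nonneg n.cast_nonneg _).trans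
            (Literature.NumberTheory.Sieve.GPY.sum_Ioc_rpow_neg_le hN1 (by linarith : 1 < 2 - 2 * δ))
          have hpow : (N : ℝ) ^ (1 - (2 - 2 * δ)) ≤ 4 * (N : ℝ)⁻¹ := by
            rw [show 1 - (2 - 2 * δ) = δ * 2 + (-1) by ring, Real.rpow_add hN0,
              Real.rpow_mul hN0.le, Real.rpow_neg_one, Real.rpow_two]
            have h4 : ((N : ℝ) ^ δ) ^ 2 ≤ 4 := by nlinarith [Real.rpow_nonneg hN0.le δ]
            gcongr
          have h8 : (N : ℝ) ^ (1 - (2 - 2 * δ)) / (2 - 2 * δ - 1) ≤ 8 * (N : ℝ)⁻¹ := by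
            rw [div_le_iff₀ (by linarith)]
            nlinarith [mul_nonneg (inv_nonneg.2 hN0.le) (by linarith : (0 : ℝ) ≤ 1 / 4 - δ)]
          have hRN : R * (N : ℝ)⁻¹ ≤ 1 / 8 := by
            rw [← div_eq_mul_inv, div_le_iff₀ hN0]; linarith
          calc 20 * (R + R ^ 2) * ∑ p ∈ T.filter (fun p : Nat.Primes ↦ ¬(p : ℕ) ≤ N),
                ((p : ℕ) : ℝ) ^ (-(2 - 2 * δ))
              ≤ 20 * (R + R ^ 2) * (8 * (N : ℝ)⁻¹) :=
                mul_le_mul_of_nonneg_left (htail.trans h8) (by positivity)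
            _ = 160 * (R * (N : ℝ)⁻¹) * (1 + R) := by ring
            _ ≤ 160 * (1 / 8) * (1 + R) := by gcongr
            _ = 20 * (1 + R) := by ring
  rw [← Finset.prod_filter_mul_prod_filter_not T (fun p : Nat.Primes ↦ (p : ℕ) ≤ N)]
  refine (mul_le_mul hA hB (Finset.prod_nonneg fun p _ ↦ norm_nonneg _)
    (Real.exp_nonneg _)).trans ?_
  rw [← Real.exp_add, Real.exp_le_exp]
  have hR12 : Real.log (R + 1) ≤ Real.log (R + 2) := Real.log_le_log (by linarith) (by linarith)
  have hlogN' : Real.log N ≤ 4 * Real.log (R + 2) := by linarith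
  nlinarith [mul_le_mul_of_nonneg_left hlogN' hR,
    mul_nonneg hR (by linarith : (0 : ℝ) ≤ 2 * Real.log (R + 2) - 1)]

/-- **The majorant** on `1 < σ ≤ 2`: for `‖z‖ ≤ R`,
`Σ ‖χ(n) z^{s(n)} n^{-σ}‖ ≤ Σ ‖z^{s(n)} n^{-σ}‖ ≤ e^{100(1+R)log(R+2)} (σ − 1)^{-R}`
(termwise `‖χ(n)‖ ≤ 1` and E1's `CappedEulerSharp.tsum_norm_term_le_sharp`). -/
theorem tsum_norm_term_twist_le_sharp {z : ℂ} {R σ : ℝ} (hz : ‖z‖ ≤ R) (hσ : 1 < σ)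
    (hσ2 : σ ≤ 2) :
    ∑' n, ‖term (fun n : ℕ ↦ χ n * z ^ (n.factorization.sum fun _ v => min v 2)) σ n‖ ≤
      Real.exp (100 * (1 + R) * Real.log (R + 2)) / (σ - 1) ^ R := by
  have hσ' : 1 < (σ : ℂ).re := by simpa using hσ
  exact (Summable.tsum_le_tsum (fun n ↦ ApTwistedEuler.norm_term_twist_le χ _ _ n)
    (ApTwistedEuler.summable_norm_term χ z hσ') (SelbergDelangeCapped.summable_norm_term z hσ')).trans
      (CappedEulerSharp.tsum_norm_term_le_sharp hz hσ hσ2)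

end ApTwistedEulerSharp

open ApTwistedEuler ApTwistedEulerSharp in
/-- **Stub (the twisted capped Euler product as SHARP engine data), PROVED.**  For a Dirichlet
character `χ mod q` there is `b ≥ 0` (namely `b = 100 + 3 ω(q)`) such that for every `R ≥ 0`,
`‖z‖ ≤ R`, the coefficients `a(n) = χ(n) z^{s(n)}` (`s(n) = Σ_{p^v ∥ n} min(v,2)`) and the product
`G(s) = ∏_p (1 + z w_p + z² w_p²/(1 − w_p))·exp(z·Log(1 − w_p))`, `w_p = χ(p) p^{-s}`, satisfy:
`G` is holomorphic on `σ > 1/2` with `‖G‖ ≤ B = exp(b (1+R) log(R+2))` on the thin half-plane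
`σ > 1 − 1/(4(R+1))`; `Σ a(n) n^{-s}` converges absolutely and equals `exp(z Σ_p −Log(1 − w_p)) G(s)`
for `σ > 1`; `Σ ‖a(n)‖ n^{-σ} ≤ B (σ − 1)^{-R}` for `1 < σ ≤ 2`; and, for `χ = χ₀`, the data
`SelbergDelange.RieszData R (1 − 1/(4(R+1))) B z a (G · exp(z Σ_{p∣q} Log(1 − p^{-s})))` of the
`ζ^z` engine. -/
theorem stub_apTwistedEulerDataSharp :
    ∀ (q : ℕ) [NeZero q] (χ : DirichletCharacter ℂ q), ∃ b : ℝ, 0 ≤ b ∧ ∀ R : ℝ, 0 ≤ R → ∀ z : ℂ, ‖z‖ ≤ R →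
      ∃ G : ℂ → ℂ, DifferentiableOn ℂ G {s : ℂ | 1 / 2 < s.re} ∧
        (∀ s : ℂ, 1 - 1 / (4 * (R + 1)) < s.re → ‖G s‖ ≤ Real.exp (b * (1 + R) * Real.log (R + 2))) ∧
        (∀ σ : ℝ, 1 < σ →
          LSeriesSummable (fun n : ℕ => χ (n : ZMod q) * z ^ (n.factorization.sum fun _ v => min v 2)) σ) ∧
        (∀ s : ℂ, 1 < s.re →
          LSeries (fun n : ℕ => χ (n : ZMod q) * z ^ (n.factorization.sum fun _ v => min v 2)) s =
            Complex.exp (z * ∑' p : Nat.Primes, -Complex.log (1 - χ ((p : ℕ) : ZMod q) * ((p : ℕ) : ℂ) ^ (-s))) * G s) ∧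
        (∀ σ : ℝ, 1 < σ → σ ≤ 2 →
          ∑' n : ℕ, ‖LSeries.term (fun n : ℕ => χ (n : ZMod q) * z ^ (n.factorization.sum fun _ v => min v 2)) σ n‖ ≤
            Real.exp (b * (1 + R) * Real.log (R + 2)) / (σ - 1) ^ R) ∧
        (χ = 1 → Literature.NumberTheory.LFunctions.SelbergDelange.RieszData R (1 - 1 / (4 * (R + 1)))
          (Real.exp (b * (1 + R) * Real.log (R + 2))) z
          (fun n : ℕ => χ (n : ZMod q) * z ^ (n.factorization.sum fun _ v => min v 2))
          (fun s : ℂ => G s * Complex.exp (z * ∑ p ∈ q.primeFactors, Complex.log (1 - ((p : ℕ) : ℂ) ^ (-s))))) := by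
  intro q _ χ
  set k : ℝ := (q.primeFactors.card : ℝ) with hk
  have hk0 : 0 ≤ k := Nat.cast_nonneg _
  refine ⟨100 + 3 * k, by positivity, fun R hR z hz ↦ ?_⟩
  -- the constants
  have hlog0 : 0 ≤ Real.log (R + 2) := Real.log_nonneg (by linarith)
  have hlog2 : (2 : ℝ) / 3 ≤ Real.log (R + 2) :=
    le_trans (by linarith [Real.log_two_gt_d9]) (Real.log_le_log two_pos (by linarith))
  have hP0 : 0 ≤ (1 + R) * Real.log (R + 2) := mul_nonneg (by linarith) hlog0
  have hδ : 1 / (4 * (R + 1)) ≤ 1 / 4 := one_div_le_one_div_of_le (by norm_num) (by linarith)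
  set B : ℝ := Real.exp ((100 + 3 * k) * (1 + R) * Real.log (R + 2)) with hB
  have hB99 : Real.exp (99 * (1 + R) * Real.log (R + 2)) ≤ B :=
    Real.exp_le_exp.2 (by nlinarith [mul_nonneg hk0 hP0])
  have hB100 : Real.exp (100 * (1 + R) * Real.log (R + 2)) ≤ B :=
    Real.exp_le_exp.2 (by nlinarith [mul_nonneg hk0 hP0])
  have hBcorr : Real.exp (99 * (1 + R) * Real.log (R + 2)) * Real.exp (‖z‖ * (2 * k)) ≤ B := by
    rw [← Real.exp_add, hB, Real.exp_le_exp]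
    have h1 : ‖z‖ * (2 * k) ≤ R * (2 * k) := mul_le_mul_of_nonneg_right hz (by positivity)
    have h2 : 3 * k * (1 + R) * (2 / 3) ≤ 3 * k * (1 + R) * Real.log (R + 2) :=
      mul_le_mul_of_nonneg_left hlog2 (by positivity)
    nlinarith
  -- the product `G`
  set G : ℂ → ℂ := fun s ↦ ∏' p : Nat.Primes,
    (1 + z * (χ p * (p : ℂ) ^ (-s)) + z ^ 2 * (χ p * (p : ℂ) ^ (-s)) ^ 2 /
      (1 - χ p * (p : ℂ) ^ (-s))) * exp (z * log (1 - χ p * (p : ℂ) ^ (-s))) with hG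
  have hdiff : DifferentiableOn ℂ G {s : ℂ | 1 / 2 < s.re} :=
    ApTwistedEuler.differentiableOn_tprod_factor χ z
  have hGb : ∀ s : ℂ, 1 - 1 / (4 * (R + 1)) < s.re →
      ‖G s‖ ≤ Real.exp (99 * (1 + R) * Real.log (R + 2)) := fun s hs ↦
    norm_tprod_twist_le_sharp χ hR hs hz
  have hsum : ∀ σ : ℝ, 1 < σ → LSeriesSummable
      (fun n : ℕ => χ (n : ZMod q) * z ^ (n.factorization.sum fun _ v => min v 2)) σ :=
    fun σ hσ ↦ (ApTwistedEuler.summable_norm_term χ z (by simpa using hσ)).of_norm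
  have hL : ∀ s : ℂ, 1 < s.re →
      LSeries (fun n : ℕ => χ (n : ZMod q) * z ^ (n.factorization.sum fun _ v => min v 2)) s =
        exp (z * ∑' p : Nat.Primes, -log (1 - χ ((p : ℕ) : ZMod q) * ((p : ℕ) : ℂ) ^ (-s))) *
          G s :=
    fun s hs ↦ ApTwistedEuler.LSeries_eq χ z hs
  have hmaj' : ∀ σ : ℝ, 1 < σ → σ ≤ 2 →
      ∑' n : ℕ, ‖term (fun n : ℕ ↦ χ n * z ^ (n.factorization.sum fun _ v => min v 2)) σ n‖ ≤
        B / (σ - 1) ^ R := fun σ hσ hσ2 ↦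
    (tsum_norm_term_twist_le_sharp χ hz hσ hσ2).trans
      (div_le_div_of_nonneg_right hB100 (Real.rpow_nonneg (by linarith) R))
  refine ⟨G, hdiff, fun s hs ↦ (hGb s hs).trans hB99, hsum, hL, hmaj', fun hχ ↦ ?_⟩
  subst hχ
  refine ⟨hz, fun s hs ↦ ?_, fun s hs ↦ ?_, hsum, fun s hs ↦ ?_, hmaj'⟩
  · -- holomorphy on `σ > 1 - 1/(4(R+1))` (`⊂ {σ > 1/2}`)
    have hs' : 1 - 1 / (4 * (R + 1)) < s.re := hs
    have h1 := hdiff.differentiableAt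
      ((isOpen_lt continuous_const continuous_re).mem_nhds (show 1 / 2 < s.re by linarith))
    exact (h1.mul (differentiableAt_corr q z (by linarith))).differentiableWithinAt
  · -- the bound on `σ > 1 - 1/(4(R+1))`
    rw [norm_mul]
    exact (mul_le_mul (hGb s hs) (norm_corr_le q z (by linarith)) (norm_nonneg _)
      (Real.exp_nonneg _)).trans hBcorr
  · -- `Σ a(n) n^{-s} = ζ(s)^z G₁(s)`
    rw [hL s hs, tsum_neg_log_one_sub_twist_one q hs, mul_add, exp_add,
      SelbergDelange.zetaPow_eq_exp_eulerLogZeta z hs]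
    ring

end Summit.Parity.BatemanHorn.Cruxes.DiscMajorantLog.Sketch

end
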